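import Mathlib
import Literature.NumberTheory.EllipticCurves.Selmer
import HarnessLib

/-!
# Route `IsogenyRedei` — support item `SliceFrame` (stmt-Parity-14953): the parity transfer

Step (i-a) of the proof of `SliceFrame`: through the dictionary
`(−1)^{corank Sel(E_t)} = −w(t)·(−1)^{#odd p ∣ t²+1}` (`PencilSelmerDictionary`, `w` of period `2^M`)
and `ω(t²+1) = #{odd p ∣ t²+1} + [t odd]`, the parity function `λ(t) = (−1)^{ω(t²+1)}` equals
`σ(t)·(−1)^{corank Sel(E_t)}` with `σ(t) = −w(t)(−1)^t` of period `P = 2^{M+1}` and modulus one.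
Hence the Siegel–Walfisz-rate bound for the Selmer-corank parity along progressions
(`PencilSelmerParitySW`, used with exponent `2A+1` and moduli `q·P`) gives the same bound for `λ`
along every progression of modulus `q ≤ (log x)^A` (`parityRate_of_dictionary`).

The regrouping tool `abs_sum_mul_le_sum_abs_progressions` (a `Q`-periodic weight of modulus
`≤ 1` against an arbitrary sequence is dominated by the sum over residues `c mod Q` of the
progression sums) is reused by the squarefree sieve (`IsogenyRedeiSliceFrameSieve`).
-/

namespace Summit.Parity.BatemanHorn.Theorems.SliceFrame

open Finset

/-! ### A periodic twist is dominated by progression sums -/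

/-- **Periodic twists.** If `w` is `Q`-periodic (`Q ≥ 1`) with `|w| ≤ 1`, then
`|∑_{1 ≤ n ≤ y} w(n) F(n)| ≤ ∑_{c mod Q} |∑_{1 ≤ n ≤ y, n ≡ c (Q)} F(n)|`. [folklore] -/
theorem abs_sum_mul_le_sum_abs_progressions (F w : ℕ → ℝ) {Q : ℕ} (hQ : 0 < Q)
    (hw : ∀ n n' : ℕ, n ≡ n' [MOD Q] → w n = w n') (hw1 : ∀ n, |w n| ≤ 1) (y : ℕ) :
    |∑ n ∈ Finset.Icc 1 y, w n * F n|
      ≤ ∑ c ∈ Finset.range Q, |∑ n ∈ (Finset.Icc 1 y).filter (fun n : ℕ => n ≡ c [MOD Q]), F n| := by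
  classical
  have hmaps : ∀ n ∈ Finset.Icc 1 y, n % Q ∈ Finset.range Q := fun n _ =>
    Finset.mem_range.mpr (Nat.mod_lt n hQ)
  rw [← Finset.sum_fiberwise_of_maps_to hmaps (fun n => w n * F n)]
  refine (Finset.abs_sum_le_sum_abs _ _).trans (Finset.sum_le_sum fun c hc => ?_)
  have hcQ : c % Q = c := Nat.mod_eq_of_lt (Finset.mem_range.mp hc)
  have hfilter : (Finset.Icc 1 y).filter (fun n : ℕ => n % Q = c)
      = (Finset.Icc 1 y).filter (fun n : ℕ => n ≡ c [MOD Q]) := by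
    refine Finset.filter_congr (fun n _ => ?_)
    unfold Nat.ModEq
    rw [hcQ]
  have hinner : ∑ n ∈ (Finset.Icc 1 y).filter (fun n : ℕ => n % Q = c), w n * F n
      = w c * ∑ n ∈ (Finset.Icc 1 y).filter (fun n : ℕ => n ≡ c [MOD Q]), F n := by
    rw [← hfilter, Finset.mul_sum]
    refine Finset.sum_congr rfl (fun n hn => ?_)
    have hn : n % Q = c := (Finset.mem_filter.mp hn).2
    have hmod : n ≡ c [MOD Q] := by unfold Nat.ModEq; rw [hn, hcQ]
    rw [hw n c hmod]
  rw [hinner, abs_mul]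
  calc |w c| * |∑ n ∈ (Finset.Icc 1 y).filter (fun n : ℕ => n ≡ c [MOD Q]), F n|
      ≤ 1 * |∑ n ∈ (Finset.Icc 1 y).filter (fun n : ℕ => n ≡ c [MOD Q]), F n| :=
        mul_le_mul_of_nonneg_right (hw1 c) (abs_nonneg _)
    _ = _ := one_mul _

/-! ### The dictionary, pointwise -/

/-- `ω(t²+1) = #{odd primes p ∣ t²+1} + [t odd]`, in sign form: `(−1)^{ω(t²+1)} =
(−1)^{#{p ∣ t²+1, p ≠ 2}}·(−1)^t`. [folklore] -/
theorem neg_one_pow_card_primeFactors_sq_add_one (t : ℕ) :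
    (-1 : ℝ) ^ (t ^ 2 + 1).primeFactors.card
      = (-1 : ℝ) ^ ((t ^ 2 + 1).primeFactors.filter (fun p : ℕ => p ≠ 2)).card * (-1) ^ t := by
  classical
  have hsplit := Finset.card_filter_add_card_filter_not
    (s := (t ^ 2 + 1).primeFactors) (p := fun p : ℕ => p ≠ 2)
  have htwo : ((t ^ 2 + 1).primeFactors.filter (fun p : ℕ => ¬ p ≠ 2)).card
      = if 2 ∣ t ^ 2 + 1 then 1 else 0 := by
    have hf : (t ^ 2 + 1).primeFactors.filter (fun p : ℕ => ¬ p ≠ 2)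
        = if 2 ∣ t ^ 2 + 1 then {2} else ∅ := by
      ext p
      rw [Finset.mem_filter, Nat.mem_primeFactors, not_not]
      split_ifs with h
      · rw [Finset.mem_singleton]
        constructor
        · rintro ⟨-, rfl⟩; rfl
        · rintro rfl; exact ⟨⟨Nat.prime_two, h, Nat.succ_ne_zero _⟩, rfl⟩
      · simp only [Finset.notMem_empty, iff_false, not_and]
        rintro ⟨-, h2, -⟩ rfl
        exact h h2
    rw [hf]
    split_ifs <;> simp
  rw [← hsplit, pow_add, htwo]
  congr 1
  rcases Nat.even_or_odd t with ht | ht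
  · have h2 : ¬ 2 ∣ t ^ 2 + 1 := by
      intro h
      have : 2 ∣ t ^ 2 := (even_iff_two_dvd.mp ht).pow two_ne_zero |> fun h' => h'
      omega
    rw [if_neg h2, pow_zero, ht.neg_one_pow]
  · have h2 : 2 ∣ t ^ 2 + 1 := by
      have : Odd (t ^ 2) := ht.pow
      exact even_iff_two_dvd.mp (this.add_one)
    rw [if_pos h2, pow_one, ht.neg_one_pow]

/-! ### The parity transfer -/

/-- **Parity transfer (step (i-a) of `SliceFrame`).** The route decls `PencilSelmerDictionary`
(hypothesis `hD`, verbatim) and `PencilSelmerParitySW` (hypothesis `hS`, verbatim) give, for every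
`A > 0`, constants `C, x₀` with `|∑_{n ≤ x, n ≡ a (q)} (−1)^{ω(n²+1)}| ≤ C x/(log x)^A` for all
`x ≥ x₀`, `1 ≤ q ≤ (log x)^A` and all `a`.  (The hypotheses are spelled out so that this file does
not depend on the gate-rendered Theses file; they are definitionally the route decls.) [folklore] -/
theorem parityRate_of_dictionary
    (hD : ∃ M : ℕ, ∃ w : ℕ → ℤ, (∀ t : ℕ, w (t + 2 ^ M) = w t) ∧ ∀ t : ℕ, 1 ≤ t →
      (-1 : ℤ) ^ (WeierstrassCurve.selmerCorank
        (⟨0, 2 * (t : ℚ), 0, (t : ℚ) ^ 2 + 1, 0⟩ : WeierstrassCurve ℚ) 2)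
        = -(w t * (-1 : ℤ) ^ (((t ^ 2 + 1).primeFactors.filter (fun p : ℕ => p ≠ 2)).card)))
    (hS : ∀ A : ℝ, 0 < A → ∃ C : ℝ, ∃ x₀ : ℕ, ∀ x : ℕ, x₀ ≤ x → ∀ q : ℕ, 1 ≤ q →
      (q : ℝ) ≤ Real.log x ^ A → ∀ a : ℕ,
        |∑ t ∈ (Finset.Icc 1 x).filter (fun t : ℕ => t ≡ a [MOD q]),
          (-1 : ℝ) ^ (WeierstrassCurve.selmerCorank
            (⟨0, 2 * (t : ℚ), 0, (t : ℚ) ^ 2 + 1, 0⟩ : WeierstrassCurve ℚ) 2)|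
          ≤ C * (x : ℝ) / Real.log x ^ A)
    (A : ℝ) (hA : 0 < A) :
    ∃ C : ℝ, ∃ x₀ : ℕ, ∀ x : ℕ, x₀ ≤ x → ∀ q : ℕ, 1 ≤ q → (q : ℝ) ≤ Real.log x ^ A → ∀ a : ℕ,
      |∑ n ∈ (Finset.Icc 1 x).filter (fun n : ℕ => n ≡ a [MOD q]),
          (-1 : ℝ) ^ (n ^ 2 + 1).primeFactors.card| ≤ C * (x : ℝ) / Real.log x ^ A := by
  classical
  obtain ⟨M, w, hper, hdict⟩ := hD
  obtain ⟨C, x₁, hC⟩ := hS (2 * A + 1) (by positivity)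
  -- the Selmer parity and the periodic sign
  set χ : ℕ → ℝ := fun t => (-1 : ℝ) ^ (WeierstrassCurve.selmerCorank
      (⟨0, 2 * (t : ℚ), 0, (t : ℚ) ^ 2 + 1, 0⟩ : WeierstrassCurve ℚ) 2) with hχ
  set σ : ℕ → ℝ := fun t => -((w t : ℝ) * (-1) ^ t) with hσ
  set P : ℕ := 2 ^ (M + 1) with hP
  have hP2 : 2 ≤ P := by
    rw [hP]
    calc 2 = 2 ^ 1 := (pow_one 2).symm
      _ ≤ 2 ^ (M + 1) := Nat.pow_le_pow_right (by norm_num) (by omega)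
  -- `w` has modulus one
  have hw_sq : ∀ t : ℕ, (w t : ℝ) ^ 2 = 1 := by
    have h1 : ∀ t : ℕ, 1 ≤ t → (w t : ℝ) ^ 2 = 1 := by
      intro t ht
      have h := hdict t ht
      have habs : |w t| = 1 := by
        have h' := congrArg (fun z : ℤ => |z|) h
        simp only [abs_neg, abs_mul, abs_pow, abs_neg, abs_one, one_pow, mul_one] at h'
        exact h'.symm
      have : (w t) ^ 2 = 1 := by
        rcases abs_eq (zero_le_one) |>.mp habs with h | h <;> rw [h] <;> norm_num
      exact_mod_cast this
    intro t
    rw [← hper t]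
    exact h1 _ (le_add_left (Nat.one_le_two_pow))
  have hσ1 : ∀ t, |σ t| ≤ 1 := by
    intro t
    have habs : |(w t : ℝ)| = 1 :=
      (pow_eq_one_iff_of_nonneg (abs_nonneg _) two_ne_zero).mp (by rw [sq_abs]; exact hw_sq t)
    simp only [hσ, abs_neg, abs_mul, abs_pow, abs_one, one_pow, mul_one, habs, le_refl]
  -- `σ` is `P`-periodic
  have hσper : Function.Periodic σ P := by
    intro t
    have hw2 : Function.Periodic w (2 ^ (M + 1)) := fun s => by
      rw [pow_succ, mul_two, ← add_assoc, hper, hper]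
    have hev : Even (2 ^ (M + 1)) := (Nat.even_pow' (by omega)).mpr even_two
    simp only [hσ, hP]
    rw [hw2 t, pow_add, hev.neg_one_pow, mul_one]
  -- pointwise dictionary: `λ = σ · χ` for `t ≥ 1`
  have hpt : ∀ t : ℕ, 1 ≤ t → (-1 : ℝ) ^ (t ^ 2 + 1).primeFactors.card = σ t * χ t := by
    intro t ht
    have h := hdict t ht
    have hR : χ t = -((w t : ℝ) * (-1 : ℝ) ^ ((t ^ 2 + 1).primeFactors.filter
        (fun p : ℕ => p ≠ 2)).card) := by
      have h' : (((-1 : ℤ) ^ (WeierstrassCurve.selmerCorank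
          (⟨0, 2 * (t : ℚ), 0, (t : ℚ) ^ 2 + 1, 0⟩ : WeierstrassCurve ℚ) 2) : ℤ) : ℝ)
          = ((-(w t * (-1 : ℤ) ^ ((t ^ 2 + 1).primeFactors.filter
              (fun p : ℕ => p ≠ 2)).card) : ℤ) : ℝ) := by rw [h]
      push_cast at h'
      exact h'
    rw [neg_one_pow_card_primeFactors_sq_add_one t]
    -- `(−1)^{odd} = −w χ`
    have hodd : (-1 : ℝ) ^ ((t ^ 2 + 1).primeFactors.filter (fun p : ℕ => p ≠ 2)).card
        = -((w t : ℝ) * χ t) := by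
      rw [hR]
      have := hw_sq t
      linear_combination -(-1 : ℝ) ^ ((t ^ 2 + 1).primeFactors.filter
        (fun p : ℕ => p ≠ 2)).card * this
    rw [hodd, hσ]
    ring
  -- the threshold
  refine ⟨C, max x₁ ⌈Real.exp P⌉₊, fun x hx q hq hqA a => ?_⟩
  have hx₁ : x₁ ≤ x := le_of_max_le_left hx
  have hxP : (⌈Real.exp P⌉₊ : ℕ) ≤ x := le_of_max_le_right hx
  have hlogP : (P : ℝ) ≤ Real.log x := by
    have h1 : Real.exp P ≤ x := (Nat.le_ceil _).trans (by exact_mod_cast hxP)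
    have h2 := Real.log_le_log (Real.exp_pos _) h1
    rwa [Real.log_exp] at h2
  have hL1 : (1 : ℝ) ≤ Real.log x := le_trans (by exact_mod_cast (by omega : 1 ≤ P)) hlogP
  have hL0 : (0 : ℝ) < Real.log x := zero_lt_one.trans_le hL1
  set L := Real.log x with hL
  -- the modulus `q P`
  have hqP : 0 < q * P := Nat.mul_pos (by omega) (by omega)
  have hqP_le : ((q * P : ℕ) : ℝ) ≤ L ^ (A + 1) := by
    calc ((q * P : ℕ) : ℝ) = (q : ℝ) * P := by push_cast; ring
      _ ≤ L ^ A * L := mul_le_mul hqA hlogP (Nat.cast_nonneg _) (Real.rpow_nonneg hL0.le _)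
      _ = L ^ (A + 1) := by rw [Real.rpow_add hL0, Real.rpow_one]
  have hqPA : ((q * P : ℕ) : ℝ) ≤ L ^ (2 * A + 1) :=
    hqP_le.trans (Real.rpow_le_rpow_of_exponent_le hL1 (by linarith))
  -- rewrite the sum as a twisted sum over `[1, x]`
  set wq : ℕ → ℝ := fun n => if n ≡ a [MOD q] then σ n else 0 with hwq
  have hsum : ∑ n ∈ (Finset.Icc 1 x).filter (fun n : ℕ => n ≡ a [MOD q]),
        (-1 : ℝ) ^ (n ^ 2 + 1).primeFactors.card
      = ∑ n ∈ Finset.Icc 1 x, wq n * χ n := by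
    rw [Finset.sum_filter]
    refine Finset.sum_congr rfl (fun n hn => ?_)
    have hn1 : 1 ≤ n := (Finset.mem_Icc.mp hn).1
    simp only [hwq]
    split_ifs with h
    · exact hpt n hn1
    · exact (zero_mul _).symm
  have hwq_per : ∀ n n' : ℕ, n ≡ n' [MOD q * P] → wq n = wq n' := by
    intro n n' h
    have hq' : n ≡ n' [MOD q] := h.of_mul_right P
    have hP' : n ≡ n' [MOD P] := h.of_mul_left q
    have hσnn' : σ n = σ n' := by
      rw [← hσper.map_mod_nat n, ← hσper.map_mod_nat n']
      exact congrArg σ hP'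
    simp only [hwq]
    by_cases han : n ≡ a [MOD q]
    · rw [if_pos han, if_pos (hq'.symm.trans han), hσnn']
    · rw [if_neg han, if_neg (fun h' => han (hq'.trans h'))]
  have hwq1 : ∀ n, |wq n| ≤ 1 := by
    intro n
    simp only [hwq]
    split_ifs
    · exact hσ1 n
    · simp
  rw [hsum]
  refine (abs_sum_mul_le_sum_abs_progressions χ wq hqP hwq_per hwq1 x).trans ?_
  -- each progression sum is bounded by `PencilSelmerParitySW`
  have hbound : ∀ c ∈ Finset.range (q * P),
      |∑ n ∈ (Finset.Icc 1 x).filter (fun n : ℕ => n ≡ c [MOD q * P]), χ n|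
        ≤ C * (x : ℝ) / L ^ (2 * A + 1) :=
    fun c _ => hC x hx₁ (q * P) hqP hqPA c
  have hT0 : 0 ≤ C * (x : ℝ) / L ^ (2 * A + 1) :=
    (abs_nonneg _).trans (hbound 0 (Finset.mem_range.mpr hqP))
  calc ∑ c ∈ Finset.range (q * P),
        |∑ n ∈ (Finset.Icc 1 x).filter (fun n : ℕ => n ≡ c [MOD q * P]), χ n|
      ≤ ∑ _c ∈ Finset.range (q * P), C * (x : ℝ) / L ^ (2 * A + 1) := Finset.sum_le_sum hbound
    _ = ((q * P : ℕ) : ℝ) * (C * (x : ℝ) / L ^ (2 * A + 1)) := by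
        rw [Finset.sum_const, Finset.card_range, nsmul_eq_mul]
    _ ≤ L ^ (A + 1) * (C * (x : ℝ) / L ^ (2 * A + 1)) :=
        mul_le_mul_of_nonneg_right hqP_le hT0
    _ = C * (x : ℝ) / L ^ A := by
        have hsplit : L ^ (2 * A + 1) = L ^ (A + 1) * L ^ A := by
          rw [← Real.rpow_add hL0]; ring_nf
        rw [hsplit]
        have hne1 : L ^ (A + 1) ≠ 0 := (Real.rpow_pos_of_pos hL0 _).ne'
        have hne2 : L ^ A ≠ 0 := (Real.rpow_pos_of_pos hL0 _).ne'
        field_simp
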